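import Summits.HodgeConjecture.HodgeConjecture.Theorems.F0P3cStCharTSScTracePackage   -- ★ p852860 E2-5a (F0P3a-p06): §0 package facts at `Gqs`, §1 `scCoeff_*` heads (class-level traces, POS-ONE, SchwartzBruhat)
import Summits.HodgeConjecture.HodgeConjecture.Theorems.F0P3cStCharTSScEllReading     -- ★ p852863 E2-4 FILE 3 (F0P3b-p01): `orbInt_smul_matrixCoeff_eq_conj_char_on_ellG` (elliptic clause)
import Summits.HodgeConjecture.HodgeConjecture.Theorems.F0P3cStCharTSWeylHypFibre     -- ★ `isUnit_sub_of_isRegularElt_glDiagonal`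
import Summits.HodgeConjecture.HodgeConjecture.Theorems.F0P3cStCharTSPctOut           -- ★ PCT `pseudoCoeffTrace_Gqs` (for (N1)(N0))
import Literature.NumberTheory.Rogawski1990.U3SupercuspidalCoefficientSelberg         -- ★ E2-3b FILE 2 (LH1-p01): `classOrbitalIntegral_matrixCoeff_eq_zero_of_isSupercuspidal` (S5)
import Literature.NumberTheory.Rogawski1990.Ch12Sec6                                  -- ★ carpet: `PseudoCoeffTrace`, `Prop1261a`
import HarnessLib

/-!
# F0 · P3c · line LH6 «StCharTS» — «SC-PSEUDO-COEFF @ datum» (census HC-SC §2 E2-5b): the normalised matrix coefficient of a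
# SUPERCUSPIDAL class is a PSEUDO-COEFFICIENT; `⟨χ_π, χ_π⟩_e = 1` and `⟨χ_σ, χ_π⟩_e = 0`

Cell `pub/hodgecm-mathlib` (D-0151), FLOOR 0, crux item H413 = `stmt-HodgeConjecture-24833` (`--supports` lane, helper; seat F0P3a-p02 (g26), E2 dealer
by LEAD T14-69 (1)); CENSUS «HC-SC» v1.1 §2 **E2-5b** — the ASSEMBLY at a §12.5 datum `𝔇` on `Gqs L v = U(Φ₃)(L⁺_v)` (non-split `v`) of the rule-20
generic bricks E2-1 ★ p852781∕p852790 (Schur orthogonality, F0P3a-p06), E2-2 ★ p852824∕p852832 (coefficient traces, LH5-p04), E2-3a ★ p852769∕p852804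
(cusp forms, this seat), E2-3b ★ p852880∕FILE 2 (Selberg, LH1-p01:
`Rogawski1990.classOrbitalIntegral_matrixCoeff_eq_zero_of_isSupercuspidal`), E2-4 ★ p852863 (elliptic reading, F0P3b-p01 over LH5-p02's core) and
E2-5a ★ `F0P3cStCharTSScTracePackage` (F0P3a-p06).  THEOREMS ONLY (no `def`, no instance, no notation, no named fact, no `sorry`); `𝔇` a BINDER.
HONEST LABEL: count-neutral (these bricks shrink LABELS inside (S-𝔑): the supercuspidal instances of K1 `PseudoCoeffExists`, K2 `Prop1261a`,
K3 `Prop1261b`, POS-ONE; they close no node — T14-69); HC_CM is proved only modulo the 7 printed citations (2 remaining named inputs hLiu418 =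
stmt-HodgeConjecture-24832, h413 = stmt-HodgeConjecture-24833) until rung 0 closes.

THE MATHEMATICS [Rogawski1990 §12.6 p. 187 «… `f_π` is a matrix coefficient if `π` is supercuspidal»; Prop. 12.6.1 (a)(b) p. 188; HarishChandra1970
Part I §1 Thm 1, Part III, Part V §4 Thm 12].  `π = IrrClass.mk r` supercuspidal, `B` an invariant positive-definite Hermitian form on `r.V` (★ E2-5a §0),
`v₁ ≠ 0`, `u_{v₁}(g) = B (r.ρ g v₁) v₁`, `f_π := ((∫ ‖B (r.ρ x v₁) v₁‖² dνQv) ∕ re B v₁ v₁)⁻¹ • u_{v₁}` (★ E2-2's `f_v`; `f_π(1) = d(π) > 0`).  Then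
`𝔇.IsPseudoCoeff π f_π`: (1) `f_π ∈ C_c^∞` (★ E2-5a `scCoeff_mem_schwartzBruhat`); (2) at `γ ∈ G^r ∖ G^e` — by the pin `hE` these are the conjugates
of REGULAR diagonal elements (★ `hyperbolicSet`) — `Φ(γ, f_π) = 0` (SELBERG, ★ E2-3b (S5): Iwasawa unfolding + cusp-form `N`-integrals; `f_π` is
`c · conj` of the LINEAR coefficient `g ↦ B v₁ (r.ρ g v₁)`, §1 `classOrbitalIntegral_const_mul_conj`); (3) at `γ ∈ G^e`, `Φ(γ, f_π) = conj χ_π(γ)`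
(★ E2-4 `orbInt_smul_matrixCoeff_eq_conj_char_on_ellG`, its (T2) binder discharged by ★ E2-2 `integral_integral_mul_sesqForm_conj_eq`, and the scalar
identification `conj (κ · B v₁ v₁) = (∫‖…‖²) ∕ re B v₁ v₁`, §1).  With ★ PCT `Tr σ(f) = ⟨χ_σ, χ_π⟩_e` for a pseudo-coefficient `f` of `π` and ★ E2-5a's
class-level traces (`Tr π(f_π) = 1`, `Tr σ(f_π) = 0` for `σ ≠ π`): (N1) `⟨χ_π, χ_π⟩_e = 1` (K2 = [H₄] Thm 17 at supercuspidals) and (N0) `⟨χ_σ, χ_π⟩_e = 0`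
(K3 at `(σ, π)`, `π` supercuspidal).

* §1 `classOrbitalIntegral_const_mul_conj`, `conj_kappa_mul_sesqForm_self_eq` (plumbing) · §2 **`isPseudoCoeff_scCoeff`** ·
  §3 **`exists_isPseudoCoeff_of_isSupercuspidal`** ((P): K1-sc ∧ POS-ONE-sc ∧ traces) · §4 **`innerG_char_self_eq_one_of_isSupercuspidal`** (N1),
  **`innerG_char_eq_zero_of_ne_of_isSupercuspidal`** (N0).

## References
* [Rogawski1990] J. D. Rogawski, *Automorphic Representations of Unitary Groups in Three Variables*, Ann. of Math. Stud. 123 (1990), §12.6 pp. 187–188.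
* [HarishChandra1970] Harish-Chandra (notes by G. van Dijk), *Harmonic Analysis on Reductive p-adic Groups*, LNM 162 (1970), Part I §1, §3; Part V §4.
-/

set_option autoImplicit false
-- the mandated namespace has the single-problem summit's repeated segment (`HodgeConjecture.HodgeConjecture`)
set_option linter.dupNamespace false

noncomputable section

open NumberField IsDedekindDomain MeasureTheory MeasureTheory.Measure Filter Topology Set
open scoped Matrix MatrixGroups ComplexConjugate
open Literature.NumberTheory.Rogawski1990 Literature.NumberTheory.Rogawski1990.Ch12Sec5
open Literature.NumberTheory.Automorphic Literature.NumberTheory.Automorphic.UnitaryGroup Literature.MeasureTheory.Group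

namespace Summit.HodgeConjecture.HodgeConjecture.Cruxes.H413.F0P3cStCharTSScPseudoCoeff

open Summit.HodgeConjecture.HodgeConjecture.Cruxes.H413
open Summit.HodgeConjecture.HodgeConjecture.Cruxes.H413.F0P3cStCharTSTorusDefs

/-! ## §1 Plumbing: `Φ(⟦γ⟧, c · conj f) = c · conj Φ(⟦γ⟧, f)`; the scalar `conj (κ · B v v) = (∫‖B(ρ x v)v‖²) ∕ re B v v` -/

section Plumbing

variable {G : Type*} [Group G] [∀ γ : G, MeasurableSpace (G ⧸ Subgroup.centralizer ({γ} : Set G))]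

/-- `Φ(⟦γ⟧, c · conj f) = c · conj Φ(⟦γ⟧, f)` for every orbital measure family (linearity and conjugation pass through the Bochner integral over
`G ⧸ Z(γ)`; no integrability needed). [cite: Rogawski1990, §4.9 p. 54] -/
theorem classOrbitalIntegral_const_mul_conj (m : OrbitalMeasureFamily G) (f : G → ℂ) (c : ℂ) (γ : ConjClasses G) :
    classOrbitalIntegral m (fun x => c * conj (f x)) γ = c * conj (classOrbitalIntegral m f γ) := by
  rw [classOrbitalIntegral_eq, classOrbitalIntegral_eq, orbitalIntegral_eq_integral_descConj, orbitalIntegral_eq_integral_descConj,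
    ← integral_conj, ← integral_const_mul]
  refine integral_congr_ae (Eventually.of_forall fun y => ?_)
  induction y using QuotientGroup.induction_on with
  | H x => rfl

/-- For a Hermitian form with `0 < re B v v`: `conj ((∫‖B(ρ x v)v‖² ∕ (re B v v)²) · B v v) = (∫‖B(ρ x v)v‖²) ∕ re B v v` — the scalar of ★ E2-4's
`(conj a)⁻¹ • u_v` IS the scalar of ★ E2-2's `f_v`. [cite: HarishChandra1970, Part I §1 Theorem 1 (a)] -/
theorem conj_kappa_mul_sesqForm_self_eq {V : Type*} [AddCommGroup V] [Module ℂ V] (B : V →ₗ⋆[ℂ] V →ₗ[ℂ] ℂ) (hBsymm : B.IsSymm)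
    (v : V) (hv : 0 < (B v v).re) (I : ℝ) :
    conj (((I / (B v v).re ^ 2 : ℝ) : ℂ) * B v v) = ((I / (B v v).re : ℝ) : ℂ) := by
  obtain ⟨b, hb⟩ : ∃ b : ℝ, B v v = (b : ℂ) := ⟨(B v v).re, (Complex.conj_eq_iff_re.1 (hBsymm.eq v v)).symm⟩
  have hb0 : (b : ℂ) ≠ 0 := by
    have h := hv
    rw [hb, Complex.ofReal_re] at h
    exact_mod_cast h.ne'
  rw [map_mul, Complex.conj_ofReal, hBsymm.eq v v, hb, Complex.ofReal_re]
  push_cast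
  field_simp

end Plumbing

/-! ## §2 `f_π` is a pseudo-coefficient of the supercuspidal class `π = IrrClass.mk r` -/

section Datum

variable (L : Type) [Field L] [NumberField L] [IsCMField L] (v : HeightOneSpectrum (𝓞 ↥(maximalRealSubfield L)))

set_option maxHeartbeats 1600000 in
set_option synthInstance.maxHeartbeats 400000 in
-- instance-term unification on the CM local carriers (as ★ ScEllReading ∕ PsVanish)
/-- **`f_π` IS A PSEUDO-COEFFICIENT OF THE SUPERCUSPIDAL CLASS `π = IrrClass.mk r`** at every §12.5 datum `𝔇` on `U(Φ₃)(L⁺_v)` (non-split `v`) with the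
rung-0 pins hC01 `hμG`, hC04 `horb`, hC05 `hreg`, `hE` (the elliptic set = regular elements off ★ `hyperbolicSet`), `hchar` (M1∀) VERBATIM, a canonical
family `mQv` (the hyperbolic clause by ★ E2-3b (S5) `classOrbitalIntegral_matrixCoeff_eq_zero_of_isSupercuspidal`): `𝔇.IsPseudoCoeff (IrrClass.mk r) f_π` for `f_π = ((∫‖B(r.ρ x v₁)v₁‖²)∕re B v₁ v₁)⁻¹ • u_{v₁}`.
Clause 1 ★ E2-5a; clause 2 (off `G^e`) ★ E2-3b through §1; clause 3 (on `G^e`) ★ E2-4 with (T2) := ★ E2-2.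
[cite: Rogawski1990, §12.6 p. 187] [cite: HarishChandra1970, Part V §4 Theorem 12] -/
theorem isPseudoCoeff_scCoeff
    (hns : ∀ w : PlacesOver L v, IsCMField.complexConj L • w.1 = w.1)
    [MeasurableSpace (Gqs L v)] [BorelSpace (Gqs L v)]
    [∀ γ : Gqs L v, MeasurableSpace (Gqs L v ⧸ Subgroup.centralizer ({γ} : Set (Gqs L v)))]
    [∀ γ : Gqs L v, BorelSpace (Gqs L v ⧸ Subgroup.centralizer ({γ} : Set (Gqs L v)))]
    [MeasurableSpace (Gqs L v ⧸ Subgroup.center (Gqs L v))]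
    {H : Type} [Group H] [TopologicalSpace H] [IsTopologicalGroup H] [MeasurableSpace H]
    (νQv : Measure (Gqs L v)) [νQv.IsHaarMeasure] [νQv.IsMulRightInvariant]
    (mQv : OrbitalMeasureFamily (Gqs L v))
    (hcanQ : mQv.IsCanonical (fun γ => IsRegularElt (γ.val : GL (Fin 3) (UnitaryGroup.LocalRing L v))) νQv)
    (𝔇 : EllipticData (Gqs L v) H)
    (hμG : 𝔇.μG = νQv) (horb : 𝔇.orb = mQv)
    (hreg : ∀ γ : Gqs L v, γ ∈ 𝔇.regG ↔ IsRegularElt (γ.val : GL (Fin 3) (UnitaryGroup.LocalRing L v)))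
    (hE : ∀ γ : Gqs L v, γ ∈ 𝔇.ellG ↔ IsRegularElt (γ.val : GL (Fin 3) (UnitaryGroup.LocalRing L v)) ∧ γ ∉ hyperbolicSet L v)
    (hM1 : ∀ π : IrrClass (Gqs L v), Measurable (𝔇.char π) ∧ LocallyIntegrable (𝔇.char π) 𝔇.μG ∧
      (∀ x ∈ 𝔇.regG, ∀ᶠ y in 𝓝 x, 𝔇.char π y = 𝔇.char π x) ∧
      ∀ φ : Gqs L v → ℂ, IsLocSmooth φ → π.smoothTrace 𝔇.μG φ = ∫ x, φ x * 𝔇.char π x ∂𝔇.μG)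
    (r : SmoothIrrep (Gqs L v)) (hr : (IrrClass.mk r).IsSupercuspidal)
    (B : r.V →ₗ⋆[ℂ] r.V →ₗ[ℂ] ℂ) (hBsymm : B.IsSymm) (hBpos : ∀ w : r.V, w ≠ 0 → 0 < (B w w).re)
    (hBinv : ∀ (g : Gqs L v) (w w' : r.V), B (r.ρ g w) (r.ρ g w') = B w w')
    {v₁ : r.V} (hv₁ : v₁ ≠ 0) :
    𝔇.IsPseudoCoeff (IrrClass.mk r)
      ((((∫ x, ‖B (r.ρ x v₁) v₁‖ ^ 2 ∂νQv) / (B v₁ v₁).re : ℝ) : ℂ)⁻¹ • fun g => B (r.ρ g v₁) v₁) := by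
  haveI : NonarchimedeanGroup (Gqs L v) := F0P3cStCharTSScTracePackage.nonarchimedeanGroup_Gqs L v
  haveI : νQv.IsInvInvariant := F0P3cStCharTSScTracePackage.isInvInvariant_haar_Gqs L v νQv
  have hadm : r.ρ.IsAdmissible := F0P3cStCharTSScTracePackage.isAdmissible_smoothIrrep L v hns r
  have hsc : r.ρ.IsSupercuspidal := (IrrClass.isSupercuspidal_mk r).1 hr
  have hZ : IsCompact ((Subgroup.center (Gqs L v) : Subgroup (Gqs L v)) : Set (Gqs L v)) := F0P3cStCharTSParField.isCompact_center_Gqs L v hns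
  -- the scalar `a = κ · B v₁ v₁` of ★ E2-4 and its conjugate
  set I : ℝ := ∫ x, ‖B (r.ρ x v₁) v₁‖ ^ 2 ∂νQv with hI
  set a : ℂ := ((I / (B v₁ v₁).re ^ 2 : ℝ) : ℂ) * B v₁ v₁ with ha
  have hIpos : 0 < I := Representation.IsSupercuspidal.integral_norm_sq_sesqForm_pos hsc hZ r.isSmooth hBsymm hBpos hBinv νQv hv₁
  have hre : 0 < (B v₁ v₁).re := hBpos v₁ hv₁
  have hane : a ≠ 0 := by
    have hBne : B v₁ v₁ ≠ 0 := fun h => by rw [h, Complex.zero_re] at hre; exact lt_irrefl _ hre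
    refine mul_ne_zero ?_ hBne
    exact_mod_cast (div_pos hIpos (pow_pos hre 2)).ne'
  have hconja : conj a = ((I / (B v₁ v₁).re : ℝ) : ℂ) := conj_kappa_mul_sesqForm_self_eq B hBsymm v₁ hre I
  -- the pseudo-coefficient as `(conj a)⁻¹ • u_{v₁}`
  have hf : ((((∫ x, ‖B (r.ρ x v₁) v₁‖ ^ 2 ∂νQv) / (B v₁ v₁).re : ℝ) : ℂ)⁻¹ • fun g => B (r.ρ g v₁) v₁) =
      fun y => (conj a)⁻¹ * B (r.ρ y v₁) v₁ := by
    funext y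
    rw [Pi.smul_apply, smul_eq_mul, hconja]
  refine ⟨F0P3cStCharTSScTracePackage.scCoeff_mem_schwartzBruhat L v hns νQv r hr B hBinv v₁, ?_, ?_⟩
  · -- clause 2: off `G^e`, i.e. at the conjugates of regular diagonal elements, SELBERG
    intro γ hγ
    obtain ⟨hγr, hγe⟩ := hγ
    have hγreg : IsRegularElt (γ.val : GL (Fin 3) (UnitaryGroup.LocalRing L v)) := (hreg γ).1 hγr
    have hγhyp : γ ∈ hyperbolicSet L v := by
      by_contra h
      exact hγe ((hE γ).2 ⟨hγreg, h⟩)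
    obtain ⟨t, ht, hconj⟩ := hγhyp
    obtain ⟨d, hd⟩ := (mem_torusU_iff _).1 t.2
    have hdreg : ∀ i j, i ≠ j → IsUnit ((d i : UnitaryGroup.LocalRing L v) - d j) := fun i j hij =>
      F0P3cStCharTSWeylHypFibre.isUnit_sub_of_isRegularElt_glDiagonal (hd ▸ ht) hij
    -- `f_π = (conj a)⁻¹ · conj (B v₁ (r.ρ · v₁))`, and the LINEAR coefficient `B v₁ (r.ρ · v₁)` has vanishing orbital integral at `⟦γ⟧`
    have hψ : (B v₁ : Module.Dual ℂ r.V) ∈ r.ρ.contragredient := Representation.sesqForm_apply_mem_contragredient r.isSmooth B hBinv v₁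
    have h0 := Literature.NumberTheory.Rogawski1990.classOrbitalIntegral_matrixCoeff_eq_zero_of_isSupercuspidal L hns νQv hcanQ hZ r hr
      (B v₁) hψ v₁ t hd hdreg hconj
    show classOrbitalIntegral 𝔇.orb _ (ConjClasses.mk γ) = 0
    rw [horb, hf]
    have hfun : (fun y => (conj a)⁻¹ * B (r.ρ y v₁) v₁) = fun y => (conj a)⁻¹ * conj (B v₁ (r.ρ y v₁)) := by
      funext y
      rw [hBsymm.eq]
    rw [hfun, classOrbitalIntegral_const_mul_conj, h0, map_zero, mul_zero]
  · -- clause 3: on `G^e`, the elliptic reading (★ E2-4) with (T2) := ★ E2-2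
    rw [hf]
    refine F0P3cStCharTSScEllReading.orbInt_smul_matrixCoeff_eq_conj_char_on_ellG L v hns νQv mQv hcanQ 𝔇 hμG horb hreg
      (fun γ hγ => (hE γ).1 hγ) hM1 r hsc B hBsymm hBinv v₁ a hane ?_
    intro φ hφ
    have h := Representation.IsSupercuspidal.integral_integral_mul_sesqForm_conj_eq (ρ := r.ρ) hadm hsc hZ hBsymm hBpos hBinv νQv
      (φ := φ) ⟨hφ.1, hφ.2⟩ hv₁ v₁
    rw [IrrClass.smoothTrace_mk, h, ha, hI]

/-! ## §3 (P): existence — pseudo-coefficient, POS-ONE and the two trace identities, for every supercuspidal class -/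

set_option maxHeartbeats 1600000 in
set_option synthInstance.maxHeartbeats 400000 in
-- instance-term unification on the CM local carriers
/-- **(P) «SC-PSEUDO-COEFF».**  At every §12.5 datum on `U(Φ₃)(L⁺_v)` (pins as in `isPseudoCoeff_scCoeff`), every SUPERCUSPIDAL
class `π` has a pseudo-coefficient `f` [Rogawski1990, §12.6 p. 187 «The existence of pseudo-coefficients …», at supercuspidals WITHOUT [K]] with
`f(1) = d(π)` a positive real («Plancherel» positivity at supercuspidals), `Tr π(f) = 1` and `Tr σ(f) = 0` for every class `σ ≠ π`.
[cite: Rogawski1990, §12.6 p. 187; Prop. 12.6.1 (a) p. 188] [cite: HarishChandra1970, Part I §1 Theorem 1] -/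
theorem exists_isPseudoCoeff_of_isSupercuspidal
    (hns : ∀ w : PlacesOver L v, IsCMField.complexConj L • w.1 = w.1)
    [MeasurableSpace (Gqs L v)] [BorelSpace (Gqs L v)]
    [∀ γ : Gqs L v, MeasurableSpace (Gqs L v ⧸ Subgroup.centralizer ({γ} : Set (Gqs L v)))]
    [∀ γ : Gqs L v, BorelSpace (Gqs L v ⧸ Subgroup.centralizer ({γ} : Set (Gqs L v)))]
    [MeasurableSpace (Gqs L v ⧸ Subgroup.center (Gqs L v))]
    {H : Type} [Group H] [TopologicalSpace H] [IsTopologicalGroup H] [MeasurableSpace H]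
    (νQv : Measure (Gqs L v)) [νQv.IsHaarMeasure] [νQv.IsMulRightInvariant]
    (mQv : OrbitalMeasureFamily (Gqs L v))
    (hcanQ : mQv.IsCanonical (fun γ => IsRegularElt (γ.val : GL (Fin 3) (UnitaryGroup.LocalRing L v))) νQv)
    (𝔇 : EllipticData (Gqs L v) H)
    (hμG : 𝔇.μG = νQv) (horb : 𝔇.orb = mQv)
    (hreg : ∀ γ : Gqs L v, γ ∈ 𝔇.regG ↔ IsRegularElt (γ.val : GL (Fin 3) (UnitaryGroup.LocalRing L v)))
    (hE : ∀ γ : Gqs L v, γ ∈ 𝔇.ellG ↔ IsRegularElt (γ.val : GL (Fin 3) (UnitaryGroup.LocalRing L v)) ∧ γ ∉ hyperbolicSet L v)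
    (hM1 : ∀ π : IrrClass (Gqs L v), Measurable (𝔇.char π) ∧ LocallyIntegrable (𝔇.char π) 𝔇.μG ∧
      (∀ x ∈ 𝔇.regG, ∀ᶠ y in 𝓝 x, 𝔇.char π y = 𝔇.char π x) ∧
      ∀ φ : Gqs L v → ℂ, IsLocSmooth φ → π.smoothTrace 𝔇.μG φ = ∫ x, φ x * 𝔇.char π x ∂𝔇.μG) :
    ∀ π : IrrClass (Gqs L v), π.IsSupercuspidal →
      ∃ f : Gqs L v → ℂ, 𝔇.IsPseudoCoeff π f ∧ 0 < (f 1).re ∧ (f 1).im = 0 ∧ π.smoothTrace νQv f = 1 ∧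
        ∀ σ : IrrClass (Gqs L v), σ ≠ π → σ.smoothTrace νQv f = 0 := by
  intro π
  induction π using IrrClass.ind with
  | h r =>
    intro hr
    obtain ⟨B, hBsymm, hBpos, hBinv⟩ := F0P3cStCharTSScTracePackage.exists_invariantForm_of_isSupercuspidal L v hns r hr
    haveI : Nontrivial r.V := Representation.IsIrreducible.nontrivial r.ρ
    obtain ⟨v₁, hv₁⟩ := exists_ne (0 : r.V)
    exact ⟨_, isPseudoCoeff_scCoeff L v hns νQv mQv hcanQ 𝔇 hμG horb hreg hE hM1 r hr B hBsymm hBpos hBinv hv₁,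
      (F0P3cStCharTSScTracePackage.scCoeff_one_re_pos_im_zero L v hns νQv r hr B hBsymm hBpos hBinv hv₁).1,
      (F0P3cStCharTSScTracePackage.scCoeff_one_re_pos_im_zero L v hns νQv r hr B hBsymm hBpos hBinv hv₁).2,
      F0P3cStCharTSScTracePackage.smoothTrace_mk_scCoeff L v hns νQv r hr B hBsymm hBpos hBinv hv₁,
      fun σ hσ => F0P3cStCharTSScTracePackage.smoothTrace_scCoeff_eq_zero_of_ne L v hns νQv r hr B hBsymm hBpos hBinv v₁ σ hσ⟩

/-! ## §4 (N1), (N0): `⟨χ_π, χ_π⟩_e = 1` and `⟨χ_σ, χ_π⟩_e = 0` for `π` supercuspidal, `σ ≠ π` — via ★ PCT -/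

set_option maxHeartbeats 1600000 in
set_option synthInstance.maxHeartbeats 400000 in
-- instance-term unification on the CM local carriers
/-- **(N1) «SC-NORM-ONE»: `⟨χ_π, χ_π⟩_e = 1` for a SUPERCUSPIDAL class `π`** — print: «If `π` is supercuspidal, then `⟨χ_π, χ_π⟩ = 1` by [H₄], Theorem 17»
[Rogawski1990, Prop. 12.6.1 (a) proof p. 188], here IN HOUSE: ★ PCT `Tr π(f) = ⟨χ_π, χ_π⟩_e` at the pseudo-coefficient `f_π` of (P) + `Tr π(f_π) = 1`.
Extra binders = PCT's (WIF, (C1)(C2)(C3), (L2D∀)); the letter `hScN1` of ★ CLASS-NPS ∕ the supercuspidal instance of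
★ 61A-OF-NORMS' `hL2one` ∕ K2 part 2, token for token. [cite: Rogawski1990, §12.6 Prop. 12.6.1 (a) p. 188] [cite: HarishChandra1970, Part I §1 Theorem 1 (a)] -/
theorem innerG_char_self_eq_one_of_isSupercuspidal
    (hns : ∀ w : PlacesOver L v, IsCMField.complexConj L • w.1 = w.1)
    [MeasurableSpace (Gqs L v)] [BorelSpace (Gqs L v)]
    [∀ γ : Gqs L v, MeasurableSpace (Gqs L v ⧸ Subgroup.centralizer ({γ} : Set (Gqs L v)))]
    [∀ γ : Gqs L v, BorelSpace (Gqs L v ⧸ Subgroup.centralizer ({γ} : Set (Gqs L v)))]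
    [MeasurableSpace (Gqs L v ⧸ Subgroup.center (Gqs L v))]
    {H : Type} [Group H] [TopologicalSpace H] [IsTopologicalGroup H] [MeasurableSpace H]
    (νQv : Measure (Gqs L v)) [νQv.IsHaarMeasure] [νQv.IsMulRightInvariant]
    (mQv : OrbitalMeasureFamily (Gqs L v))
    (hcanQ : mQv.IsCanonical (fun γ => IsRegularElt (γ.val : GL (Fin 3) (UnitaryGroup.LocalRing L v))) νQv)
    (𝔇 : EllipticData (Gqs L v) H)
    (hμG : 𝔇.μG = νQv) (horb : 𝔇.orb = mQv)
    (hreg : ∀ γ : Gqs L v, γ ∈ 𝔇.regG ↔ IsRegularElt (γ.val : GL (Fin 3) (UnitaryGroup.LocalRing L v)))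
    (hE : ∀ γ : Gqs L v, γ ∈ 𝔇.ellG ↔ IsRegularElt (γ.val : GL (Fin 3) (UnitaryGroup.LocalRing L v)) ∧ γ ∉ hyperbolicSet L v)
    (hM1 : ∀ π : IrrClass (Gqs L v), Measurable (𝔇.char π) ∧ LocallyIntegrable (𝔇.char π) 𝔇.μG ∧
      (∀ x ∈ 𝔇.regG, ∀ᶠ y in 𝓝 x, 𝔇.char π y = 𝔇.char π x) ∧
      ∀ φ : Gqs L v → ℂ, IsLocSmooth φ → π.smoothTrace 𝔇.μG φ = ∫ x, φ x * 𝔇.char π x ∂𝔇.μG)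
    (hWIF : 𝔇.WeylIntegrationFormula) (hC1 : 𝔇.EllCartanSubset) (hC2 : 𝔇.EllCartanAE) (hC3 : 𝔇.NonEllCartanAE) (hL2 : 𝔇.L2CharOnTorusAll)
    (π : IrrClass (Gqs L v)) (hπ : π.IsSupercuspidal) :
    𝔇.innerG (𝔇.char π) (𝔇.char π) = 1 := by
  obtain ⟨f, hf, -, -, htr, -⟩ := exists_isPseudoCoeff_of_isSupercuspidal L v hns νQv mQv hcanQ 𝔇 hμG horb hreg hE hM1 π hπ
  have hPCT := F0P3cStCharTSPctOut.pseudoCoeffTrace_Gqs L v hns νQv 𝔇 hμG hreg hM1 hWIF hC1 hC2 hC3 hL2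
  rw [← hPCT π π f hf, hμG, htr]

set_option maxHeartbeats 1600000 in
set_option synthInstance.maxHeartbeats 400000 in
-- instance-term unification on the CM local carriers
/-- **(N0) «SC-ORTHOGONALITY»: `⟨χ_σ, χ_π⟩_e = 0` for `π` SUPERCUSPIDAL and any class `σ ≠ π`** [Rogawski1990, Prop. 12.6.1 (b) p. 188 at the pairs
`(σ, π)` with `π` supercuspidal; print: [K] Thm F], here IN HOUSE: ★ PCT at `σ` + `Tr σ(f_π) = 0` (Schur orthogonality across inequivalent classes).
Same binders as (N1). [cite: Rogawski1990, §12.6 Prop. 12.6.1 (b) p. 188] [cite: HarishChandra1970, Part I §1 Theorem 1 (b)] -/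
theorem innerG_char_eq_zero_of_ne_of_isSupercuspidal
    (hns : ∀ w : PlacesOver L v, IsCMField.complexConj L • w.1 = w.1)
    [MeasurableSpace (Gqs L v)] [BorelSpace (Gqs L v)]
    [∀ γ : Gqs L v, MeasurableSpace (Gqs L v ⧸ Subgroup.centralizer ({γ} : Set (Gqs L v)))]
    [∀ γ : Gqs L v, BorelSpace (Gqs L v ⧸ Subgroup.centralizer ({γ} : Set (Gqs L v)))]
    [MeasurableSpace (Gqs L v ⧸ Subgroup.center (Gqs L v))]
    {H : Type} [Group H] [TopologicalSpace H] [IsTopologicalGroup H] [MeasurableSpace H]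
    (νQv : Measure (Gqs L v)) [νQv.IsHaarMeasure] [νQv.IsMulRightInvariant]
    (mQv : OrbitalMeasureFamily (Gqs L v))
    (hcanQ : mQv.IsCanonical (fun γ => IsRegularElt (γ.val : GL (Fin 3) (UnitaryGroup.LocalRing L v))) νQv)
    (𝔇 : EllipticData (Gqs L v) H)
    (hμG : 𝔇.μG = νQv) (horb : 𝔇.orb = mQv)
    (hreg : ∀ γ : Gqs L v, γ ∈ 𝔇.regG ↔ IsRegularElt (γ.val : GL (Fin 3) (UnitaryGroup.LocalRing L v)))
    (hE : ∀ γ : Gqs L v, γ ∈ 𝔇.ellG ↔ IsRegularElt (γ.val : GL (Fin 3) (UnitaryGroup.LocalRing L v)) ∧ γ ∉ hyperbolicSet L v)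
    (hM1 : ∀ π : IrrClass (Gqs L v), Measurable (𝔇.char π) ∧ LocallyIntegrable (𝔇.char π) 𝔇.μG ∧
      (∀ x ∈ 𝔇.regG, ∀ᶠ y in 𝓝 x, 𝔇.char π y = 𝔇.char π x) ∧
      ∀ φ : Gqs L v → ℂ, IsLocSmooth φ → π.smoothTrace 𝔇.μG φ = ∫ x, φ x * 𝔇.char π x ∂𝔇.μG)
    (hWIF : 𝔇.WeylIntegrationFormula) (hC1 : 𝔇.EllCartanSubset) (hC2 : 𝔇.EllCartanAE) (hC3 : 𝔇.NonEllCartanAE) (hL2 : 𝔇.L2CharOnTorusAll)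
    (σ π : IrrClass (Gqs L v)) (hπ : π.IsSupercuspidal) (hσπ : σ ≠ π) :
    𝔇.innerG (𝔇.char σ) (𝔇.char π) = 0 := by
  obtain ⟨f, hf, -, -, -, htr0⟩ := exists_isPseudoCoeff_of_isSupercuspidal L v hns νQv mQv hcanQ 𝔇 hμG horb hreg hE hM1 π hπ
  have hPCT := F0P3cStCharTSPctOut.pseudoCoeffTrace_Gqs L v hns νQv 𝔇 hμG hreg hM1 hWIF hC1 hC2 hC3 hL2
  rw [← hPCT π σ f hf, hμG, htr0 σ hσπ]

end Datum

end Summit.HodgeConjecture.HodgeConjecture.Cruxes.H413.F0P3cStCharTSScPseudoCoeff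

end
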